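import Literature.Analysis.SpecialFunctions.OblateSpheroidalCompletenessAzimuthal
import HarnessLib

/-!
# The second eigenvalue bound `λ + ν² ≥ 2 m |ν|` for the oblate spheroidal operator

Dafermos–Rodnianski–Shlapentokh-Rothman, arXiv:1402.7034, §5.2.1, (34) (PDF p. 20): the
eigenvalues `λ_{mℓ}(ν)` of the oblate spheroidal operator satisfy `λ_{mℓ}(ν) + ν² ≥ 2|mν|`.
The printed argument: `λ + ν² cos²θ`-Rayleigh quotient; pointwise
`m²/sin²θ + ν² sin²θ ≥ 2|mν|` (AM–GM) in the Dirichlet form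
`∫ |∂_θ S|² + (m²/sin²θ - ν² cos²θ)|S|²`.

Here the eigenfunctions are only known through the **weak eigen-equation** in the
associated-Legendre Hilbert basis `e^{(m)}_k` of `L²([-1, 1])` (file
`OblateSpheroidalCompletenessAzimuthal`):
`Λ_{m,k} ⟪e_k, S⟫ - ν² ⟪e_k, x² S⟫ = λ ⟪e_k, S⟫` for all `k`, `Λ_{m,k} = (k+m)(k+m+1)`. We prove
(`lowerBound_of_weak`): **if `S ≠ 0` satisfies these equations then `2 m |ν| - ν² ≤ λ`.**

Proof (the printed one, made rigorous at the `L²` level):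
1. *Energy identity* (`hasSum_level_mul_norm_sq`): Parseval gives
   `∑_k Λ_{m,k} |⟪e_k, S⟫|² = λ ‖S‖² + ν² Re ⟪S, x² S⟫` (in particular `S` is in the form domain).
2. *Polynomial inequality* (`key_ineq`): for every real polynomial `p`,
   `B_m(T_m p, p) - ν² B_m(p, x² p) ≥ (2m|ν| - ν²) B_m(p, p)`, where `B_m(p,q) = ∫ p q (1-x²)^m` and
   `T_m` is the conjugated operator (`assocLegOp`). For `m = n + 1` this rests on the identity
   `B_{n+1}(T_{n+1} p, p) = B_n(D p, D p) + (n+1)² B_n(p, p)`, `D p = (1-x²) p' - (n+1) x p`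
   (`assocLegForm_assocLegOp_succ`; it is the polynomial form of
   `∫ (1-x²)|f'|² + m² |f|²/(1-x²)` for `f = (1-x²)^{m/2} p`, an integration by parts), and on the
   pointwise square `(n+1)² - ν² x²(1-x²) - (2(n+1)|ν| - ν²)(1-x²) = ((n+1) - |ν|(1-x²))²`.
3. *Truncation and limit*: the partial sums `S_N = ∑_{k<N} ⟪e_k, S⟫ e_k` are weighted polynomial
   classes `(1-x²)^{m/2}(p₁ + i p₂)`; step 2 applied to `p₁, p₂` gives
   `∑_{k<N} Λ_k |c_k|² - ν² Re⟪S_N, x² S_N⟫ ≥ (2m|ν| - ν²)‖S_N‖²` (`truncation_ineq`), and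
   `N → ∞` with step 1 yields the claim.

## Mathlib / tree search

Tree: `assocLegForm`, `assocLegPoly`, `assocLegBasis`, `assocLegOp`, `assocLegLevel`,
`assocLegForm_assocLegOp`, `mulSq`, `exists_hilbertBasis_oblateSpheroidal` (files
`AssociatedLegendreHilbertBasis`, `OblateSpheroidalCompleteness(Azimuthal)`),
`integral_derivative_mul` (`LegendrePolynomials`). Mathlib: `HilbertBasis.hasSum_inner_mul_inner`,
`HilbertBasis.hasSum_repr`, `HasSum.tendsto_sum_nat`, `norm_add_sq`, `le_of_tendsto_of_tendsto'`.

## References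

* M. Dafermos, I. Rodnianski, Y. Shlapentokh-Rothman, arXiv:1402.7034, §5.2.1 (34), PDF p. 20.
  [DafermosRodnianskiShlapentokhrothman2014]
-/

noncomputable section

open MeasureTheory Set Filter Topology Polynomial Finset
open scoped ENNReal NNReal ComplexConjugate InnerProductSpace

namespace Literature.Analysis.SpecialFunctions

/-! ### Polynomial calculus on `[-1, 1]` -/

/-- FTC for `polyIntegral`: `∫_{-1}^1 q' = q(1) - q(-1)`. [folklore] -/
theorem polyIntegral_derivative (q : ℝ[X]) :
    polyIntegral (derivative q) = q.eval 1 - q.eval (-1) := by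
  have h := integral_derivative_mul q 1
  simp only [eval_one, mul_one, derivative_one, eval_zero, mul_zero,
    intervalIntegral.integral_zero, sub_zero] at h
  rw [polyIntegral_apply, h]

/-- `B_m(p, x² q) = ∫ p q x² (1-x²)^m` is symmetric. [folklore] -/
theorem assocLegForm_X_sq_comm (m : ℕ) (p q : ℝ[X]) :
    assocLegForm m p (X ^ 2 * q) = assocLegForm m q (X ^ 2 * p) := by
  simp only [assocLegForm]
  congr 1
  ring

/-- `B_m(p, p) - B_m(p, x² p) = B_{m+1}(p, p)`. [folklore] -/
theorem assocLegForm_self_sub_X_sq (m : ℕ) (p : ℝ[X]) :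
    assocLegForm m p p - assocLegForm m p (X ^ 2 * p) = assocLegForm (m + 1) p p := by
  simp only [assocLegForm, assocLegWeight, ← map_sub]
  congr 1
  ring

/-- For `m = 0`: `B_0(T_0 p, p) = B_1(p', p') ≥ 0`. [folklore] -/
theorem assocLegForm_assocLegOp_zero_self (p : ℝ[X]) :
    assocLegForm 0 (assocLegOp 0 p) p = assocLegForm 1 (derivative p) (derivative p) := by
  rw [assocLegForm_assocLegOp]
  simp only [Nat.cast_zero, zero_mul, add_zero, assocLegForm, assocLegWeight,
    zero_add, pow_one]
  congr 1
  ring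

/-- **The conjugated Dirichlet identity** for `m = n + 1`:
`B_{n+1}(T_{n+1} p, p) = B_n(D p, D p) + (n+1)² B_n(p, p)` with `D p = (1-x²) p' - (n+1) x p`
(the polynomial form of `∫ (1-x²)|f'|² + m²|f|²/(1-x²)`, `f = (1-x²)^{m/2} p`; an integration by
parts whose boundary term `(n+1) x (1-x²)^{n+1} p²` vanishes at `±1`). [folklore] -/
theorem assocLegForm_assocLegOp_succ (n : ℕ) (p : ℝ[X]) :
    assocLegForm (n + 1) (assocLegOp (n + 1) p) p =
      assocLegForm n ((1 - X ^ 2) * derivative p - C ((n : ℝ) + 1) * X * p)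
          ((1 - X ^ 2) * derivative p - C ((n : ℝ) + 1) * X * p) +
        ((n : ℝ) + 1) ^ 2 * assocLegForm n p p := by
  rw [assocLegForm_assocLegOp]
  -- the boundary polynomial
  set Q : ℝ[X] := C ((n : ℝ) + 1) * X * (1 - X ^ 2) ^ (n + 1) * p ^ 2 with hQ
  have hQint : polyIntegral (derivative Q) = 0 := by
    rw [polyIntegral_derivative, hQ]
    simp
  have hder : derivative Q =
      C ((n : ℝ) + 1) * ((1 - X ^ 2) ^ (n + 1) * p ^ 2 +
        X * (C ((n : ℝ) + 1) * (1 - X ^ 2) ^ n * (-(C 2 * X)) * p ^ 2) +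
        X * (1 - X ^ 2) ^ (n + 1) * (C 2 * p * derivative p)) := by
    rw [hQ]
    simp only [derivative_mul, derivative_C, zero_mul, zero_add, derivative_X, mul_one,
      derivative_pow, Nat.cast_add, Nat.cast_one, Nat.add_sub_cancel, derivative_sub,
      derivative_one, Nat.cast_ofNat, zero_sub, map_add, map_one]
    simp only [Nat.succ_sub_one, pow_one]
    ring
  -- everything is a `polyIntegral`; reduce to a polynomial identity
  have key : (1 - X ^ 2) ^ (n + 1 + 1) * derivative p * derivative p +
      C (((n + 1 : ℕ) : ℝ) * ((n + 1 : ℕ) + 1)) * (p * p * assocLegWeight (n + 1)) =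
      ((1 - X ^ 2) * derivative p - C ((n : ℝ) + 1) * X * p) *
          ((1 - X ^ 2) * derivative p - C ((n : ℝ) + 1) * X * p) * assocLegWeight n +
        C (((n : ℝ) + 1) ^ 2) * (p * p * assocLegWeight n) + derivative Q := by
    rw [hder, assocLegWeight, assocLegWeight]
    simp only [Nat.cast_add, Nat.cast_one, C_add, C_mul, C_1, C_pow, map_ofNat]
    ring
  have h1 : polyIntegral ((1 - X ^ 2) ^ (n + 1 + 1) * derivative p * derivative p) +
      ((n + 1 : ℕ) : ℝ) * ((n + 1 : ℕ) + 1) * assocLegForm (n + 1) p p =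
      polyIntegral ((1 - X ^ 2) ^ (n + 1 + 1) * derivative p * derivative p +
        C (((n + 1 : ℕ) : ℝ) * ((n + 1 : ℕ) + 1)) * (p * p * assocLegWeight (n + 1))) := by
    rw [map_add, C_mul', map_smul, smul_eq_mul, assocLegForm]
  have h2 : assocLegForm n ((1 - X ^ 2) * derivative p - C ((n : ℝ) + 1) * X * p)
        ((1 - X ^ 2) * derivative p - C ((n : ℝ) + 1) * X * p) +
      ((n : ℝ) + 1) ^ 2 * assocLegForm n p p =
      polyIntegral (((1 - X ^ 2) * derivative p - C ((n : ℝ) + 1) * X * p) *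
          ((1 - X ^ 2) * derivative p - C ((n : ℝ) + 1) * X * p) * assocLegWeight n +
        C (((n : ℝ) + 1) ^ 2) * (p * p * assocLegWeight n) + derivative Q) := by
    rw [polyIntegral.map_add, polyIntegral.map_add, hQint, add_zero, ← assocLegForm_C_mul_left]
    simp only [assocLegForm]
    rw [show C (((n : ℝ) + 1) ^ 2) * p * p * assocLegWeight n =
      C (((n : ℝ) + 1) ^ 2) * (p * p * assocLegWeight n) by ring]
  rw [h1, h2, key]

/-- **The key polynomial inequality** (AM–GM `m²/(1-x²) + ν²(1-x²) ≥ 2m|ν|` in conjugated form):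
`(2 m |ν| - ν²) B_m(p, p) ≤ B_m(T_m p, p) - ν² B_m(p, x² p)` for every real polynomial `p`.
[cite: DafermosRodnianskiShlapentokhrothman2014, §5.2.1 (34)] -/
theorem key_ineq (m : ℕ) (ν : ℝ) (p : ℝ[X]) :
    (2 * m * |ν| - ν ^ 2) * assocLegForm m p p ≤
      assocLegForm m (assocLegOp m p) p - ν ^ 2 * assocLegForm m p (X ^ 2 * p) := by
  rcases m with _ | n
  · -- `m = 0`: `B_0(T_0 p, p) ≥ 0` and `B_0(p, x²p) ≤ B_0(p, p)`
    rw [assocLegForm_assocLegOp_zero_self]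
    have h1 := assocLegForm_self_nonneg 1 (derivative p)
    have h2 := assocLegForm_self_sub_X_sq 0 p
    have h3 := assocLegForm_self_nonneg 1 p
    simp only [Nat.cast_zero, mul_zero, zero_mul, zero_sub, zero_add] at h2 ⊢
    nlinarith [sq_nonneg ν]
  · -- `m = n + 1`
    rw [assocLegForm_assocLegOp_succ]
    set D : ℝ[X] := (1 - X ^ 2) * derivative p - C ((n : ℝ) + 1) * X * p
    set E : ℝ[X] := (C ((n : ℝ) + 1) - C |ν| * (1 - X ^ 2)) * p with hE
    have hD := assocLegForm_self_nonneg n D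
    have hEn := assocLegForm_self_nonneg n E
    -- the pointwise square
    have hsq : ((n : ℝ) + 1) ^ 2 * assocLegForm n p p -
        ν ^ 2 * assocLegForm (n + 1) p (X ^ 2 * p) -
        (2 * ((n + 1 : ℕ) : ℝ) * |ν| - ν ^ 2) * assocLegForm (n + 1) p p =
        assocLegForm n E E := by
      have hpoly : C (((n : ℝ) + 1) ^ 2) * (p * p * assocLegWeight n) -
          C (ν ^ 2) * (p * (X ^ 2 * p) * assocLegWeight (n + 1)) -
          C (2 * ((n + 1 : ℕ) : ℝ) * |ν| - ν ^ 2) * (p * p * assocLegWeight (n + 1)) =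
          E * E * assocLegWeight n := by
        rw [hE, assocLegWeight, assocLegWeight, ← sq_abs ν]
        simp only [Nat.cast_add, Nat.cast_one, C_add, C_mul, C_1, C_pow, C_sub, map_ofNat]
        ring
      simp only [assocLegForm]
      rw [← hpoly, map_sub, map_sub, C_mul', C_mul', C_mul', map_smul, map_smul, map_smul,
        smul_eq_mul, smul_eq_mul, smul_eq_mul]
    push_cast at hsq ⊢
    nlinarith [hsq, hD, hEn]

/-! ### Weighted polynomial classes: the weight `x²` and finite combinations of the `q_k` -/

/-- `x² · ((1-x²)^{m/2} q) = (1-x²)^{m/2} (x² q)` in `L²([-1, 1])`. [folklore] -/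
theorem mulSq_assocLegL2 (m : ℕ) (q : ℝ[X]) :
    mulSq (assocLegL2 m q) = assocLegL2 m (X ^ 2 * q) := by
  refine Lp.ext ?_
  filter_upwards [coeFn_mulSq (assocLegL2 m q), coeFn_assocLegL2 m q,
    coeFn_assocLegL2 m (X ^ 2 * q)] with x h1 h2 h3
  rw [h1, h2, h3, assocLegFn_apply, assocLegFn_apply, eval_mul, eval_pow, eval_X]
  push_cast
  ring

/-- `⟪(1-x²)^{m/2} p, x² (1-x²)^{m/2} q⟫ = B_m(p, x² q)`. [folklore] -/
theorem inner_assocLegL2_mulSq (m : ℕ) (p q : ℝ[X]) :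
    ⟪assocLegL2 m p, mulSq (assocLegL2 m q)⟫_ℂ = (assocLegForm m p (X ^ 2 * q) : ℂ) := by
  rw [mulSq_assocLegL2, inner_assocLegL2]

/-- The finite combination `∑_{k<N} a_k q_k` of the orthogonal polynomials `q_k = assocLegPoly m k`.
[folklore] -/
def polyCombo (m N : ℕ) (a : ℕ → ℝ) : ℝ[X] := ∑ k ∈ range N, C (a k) * assocLegPoly m k

/-- `B_m` on two combinations (orthogonality of the `q_k`). [folklore] -/
theorem assocLegForm_polyCombo (m N : ℕ) (a b : ℕ → ℝ) :
    assocLegForm m (polyCombo m N a) (polyCombo m N b) =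
      ∑ k ∈ range N, a k * b k * assocLegForm m (assocLegPoly m k) (assocLegPoly m k) := by
  rw [polyCombo, assocLegForm_sum_left]
  refine Finset.sum_congr rfl fun k hk ↦ ?_
  rw [assocLegForm_C_mul_left, polyCombo, assocLegForm_comm, assocLegForm_sum_left,
    Finset.sum_eq_single k]
  · rw [assocLegForm_C_mul_left, assocLegForm_comm]
    ring
  · intro l _ hlk
    rw [assocLegForm_C_mul_left, assocLegForm_assocLegPoly_of_ne m hlk, mul_zero]
  · intro hk'
    exact absurd hk hk'

/-- `T_m 0 = 0`. [folklore] -/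
theorem assocLegOp_zero_right (m : ℕ) : assocLegOp m 0 = 0 := by
  have h := assocLegOp_C_mul m 0 0
  rwa [C_0, zero_mul, zero_mul] at h

/-- `T_m (∑ a_k q_k) = ∑ a_k Λ_{m,k} q_k`. [folklore] -/
theorem assocLegOp_polyCombo (m N : ℕ) (a : ℕ → ℝ) :
    assocLegOp m (polyCombo m N a) = polyCombo m N (fun k ↦ a k * assocLegLevel m k) := by
  rw [polyCombo, polyCombo]
  induction N with
  | zero => rw [sum_range_zero, sum_range_zero, assocLegOp_zero_right]
  | succ N ih =>
    rw [sum_range_succ, sum_range_succ, assocLegOp_add, ih, assocLegOp_C_mul,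
      assocLegOp_assocLegPoly, ← mul_assoc, ← C_mul]

/-- `B_m(T_m ∑ a_k q_k, ∑ a_k q_k) = ∑ Λ_{m,k} a_k² B_m(q_k, q_k)`. [folklore] -/
theorem assocLegForm_assocLegOp_polyCombo (m N : ℕ) (a : ℕ → ℝ) :
    assocLegForm m (assocLegOp m (polyCombo m N a)) (polyCombo m N a) =
      ∑ k ∈ range N, assocLegLevel m k * a k ^ 2 *
        assocLegForm m (assocLegPoly m k) (assocLegPoly m k) := by
  rw [assocLegOp_polyCombo, assocLegForm_polyCombo]
  refine sum_congr rfl fun k _ ↦ ?_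
  ring

/-- The `L²` class of a combination. [folklore] -/
theorem assocLegL2_polyCombo (m N : ℕ) (a : ℕ → ℝ) :
    assocLegL2 m (polyCombo m N a) =
      ∑ k ∈ range N, (a k : ℂ) • assocLegL2 m (assocLegPoly m k) := by
  rw [polyCombo, assocLegL2_sum]
  refine sum_congr rfl fun k _ ↦ ?_
  rw [assocLegL2_C_mul]

/-! ### Truncations of an `L²` element in the basis `e^{(m)}` -/

section Truncation

variable (m : ℕ) (S : Lp ℂ 2 legendreMeasure) (N : ℕ)

/-- The real parts `a_k = Re ⟪e_k, S⟫ · c_{m,k}` of the coefficients, rescaled so that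
`∑ ⟪e_k, S⟫ e_k = (1-x²)^{m/2}(∑ a_k q_k + i ∑ b_k q_k)`. [folklore] -/
def reCoeff (k : ℕ) : ℝ := (⟪assocLegBasis m k, S⟫_ℂ).re * assocLegNormConst m k

/-- The imaginary parts `b_k = Im ⟪e_k, S⟫ · c_{m,k}`. [folklore] -/
def imCoeff (k : ℕ) : ℝ := (⟪assocLegBasis m k, S⟫_ℂ).im * assocLegNormConst m k

/-- The truncation `S_N = ∑_{k<N} ⟪e_k, S⟫ e_k`. [folklore] -/
def truncation : Lp ℂ 2 legendreMeasure :=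
  ∑ k ∈ range N, ⟪assocLegBasis m k, S⟫_ℂ • assocLegBasis m k

/-- **The truncation is a weighted complex polynomial**:
`S_N = (1-x²)^{m/2} p_a + i (1-x²)^{m/2} p_b`. [folklore] -/
theorem truncation_eq :
    truncation m S N = assocLegL2 m (polyCombo m N (reCoeff m S)) +
      Complex.I • assocLegL2 m (polyCombo m N (imCoeff m S)) := by
  rw [truncation, assocLegL2_polyCombo, assocLegL2_polyCombo, smul_sum, ← sum_add_distrib]
  refine sum_congr rfl fun k _ ↦ ?_
  conv_lhs => arg 2; rw [assocLegBasis_apply]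
  rw [smul_smul, smul_smul, ← add_smul]
  congr 1
  rw [reCoeff, imCoeff]
  apply Complex.ext
  · simp
  · simp

/-- `‖S_N‖² = B_m(p_a, p_a) + B_m(p_b, p_b)`. [folklore] -/
theorem norm_sq_truncation :
    ‖truncation m S N‖ ^ 2 =
      assocLegForm m (polyCombo m N (reCoeff m S)) (polyCombo m N (reCoeff m S)) +
        assocLegForm m (polyCombo m N (imCoeff m S)) (polyCombo m N (imCoeff m S)) := by
  rw [truncation_eq, @norm_add_sq ℂ, norm_smul, Complex.norm_I, one_mul, inner_smul_right,
    inner_assocLegL2, @norm_sq_eq_re_inner ℂ, @norm_sq_eq_re_inner ℂ, inner_assocLegL2,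
    inner_assocLegL2]
  simp only [Complex.mul_re, Complex.I_re, Complex.I_im, Complex.ofReal_re, Complex.ofReal_im,
    RCLike.re_to_complex]
  ring

/-- `Re ⟪S_N, x² S_N⟫ = B_m(p_a, x² p_a) + B_m(p_b, x² p_b)`. [folklore] -/
theorem re_inner_truncation_mulSq :
    (⟪truncation m S N, mulSq (truncation m S N)⟫_ℂ).re =
      assocLegForm m (polyCombo m N (reCoeff m S)) (X ^ 2 * polyCombo m N (reCoeff m S)) +
      assocLegForm m (polyCombo m N (imCoeff m S)) (X ^ 2 * polyCombo m N (imCoeff m S)) := by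
  rw [truncation_eq, map_add, map_smul, inner_add_left, inner_add_right, inner_add_right,
    inner_smul_left, inner_smul_left, inner_smul_right, inner_smul_right,
    inner_assocLegL2_mulSq, inner_assocLegL2_mulSq, inner_assocLegL2_mulSq,
    inner_assocLegL2_mulSq, Complex.conj_I]
  simp only [Complex.add_re, Complex.mul_re, Complex.mul_im, Complex.I_re, Complex.I_im,
    Complex.ofReal_re, Complex.ofReal_im, Complex.neg_re, Complex.neg_im]
  ring

/-- `∑_{k<N} Λ_{m,k} |⟪e_k, S⟫|² = B_m(T_m p_a, p_a) + B_m(T_m p_b, p_b)`. [folklore] -/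
theorem sum_level_mul_norm_sq :
    ∑ k ∈ range N, assocLegLevel m k * ‖⟪assocLegBasis m k, S⟫_ℂ‖ ^ 2 =
      assocLegForm m (assocLegOp m (polyCombo m N (reCoeff m S))) (polyCombo m N (reCoeff m S)) +
      assocLegForm m (assocLegOp m (polyCombo m N (imCoeff m S)))
        (polyCombo m N (imCoeff m S)) := by
  rw [assocLegForm_assocLegOp_polyCombo, assocLegForm_assocLegOp_polyCombo, ← sum_add_distrib]
  refine sum_congr rfl fun k _ ↦ ?_
  have h1 := assocLegNormConst_sq_mul m k
  rw [reCoeff, imCoeff, Complex.sq_norm, Complex.normSq_apply]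
  set F := assocLegForm m (assocLegPoly m k) (assocLegPoly m k)
  set κ := assocLegNormConst m k
  set z : ℂ := ⟪assocLegBasis m k, S⟫_ℂ
  have : assocLegLevel m k * (z.re * κ) ^ 2 * F + assocLegLevel m k * (z.im * κ) ^ 2 * F =
      assocLegLevel m k * (z.re * z.re + z.im * z.im) * (κ ^ 2 * F) := by ring
  rw [this, h1, mul_one]

/-- **The truncated inequality**:
`(2m|ν| - ν²) ‖S_N‖² ≤ ∑_{k<N} Λ_{m,k} |⟪e_k, S⟫|² - ν² Re ⟪S_N, x² S_N⟫`.
[cite: DafermosRodnianskiShlapentokhrothman2014, §5.2.1 (34)] -/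
theorem truncation_ineq (ν : ℝ) :
    (2 * m * |ν| - ν ^ 2) * ‖truncation m S N‖ ^ 2 ≤
      ∑ k ∈ range N, assocLegLevel m k * ‖⟪assocLegBasis m k, S⟫_ℂ‖ ^ 2 -
        ν ^ 2 * (⟪truncation m S N, mulSq (truncation m S N)⟫_ℂ).re := by
  rw [norm_sq_truncation, re_inner_truncation_mulSq, sum_level_mul_norm_sq]
  have ha := key_ineq m ν (polyCombo m N (reCoeff m S))
  have hb := key_ineq m ν (polyCombo m N (imCoeff m S))
  nlinarith [ha, hb]

/-- `S_N → S`. [folklore] -/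
theorem tendsto_truncation : Tendsto (fun N ↦ truncation m S N) atTop (𝓝 S) := by
  have h := (assocLegBasis m).hasSum_repr S
  have hf : (fun k ↦ (assocLegBasis m).repr S k • assocLegBasis m k) =
      fun k ↦ ⟪assocLegBasis m k, S⟫_ℂ • assocLegBasis m k := by
    funext k
    rw [HilbertBasis.repr_apply_apply]
  rw [hf] at h
  exact h.tendsto_sum_nat

end Truncation

/-! ### The energy identity and the bound -/

/-- `⟪S, x² S⟫` is real. [folklore] -/
theorem inner_mulSq_self_eq_re (S : Lp ℂ 2 legendreMeasure) :
    ⟪S, mulSq S⟫_ℂ = ((⟪S, mulSq S⟫_ℂ).re : ℂ) := by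
  rw [eq_comm, ← Complex.conj_eq_iff_re, inner_conj_symm]
  exact (ContinuousLinearMap.isSelfAdjoint_iff_isSymmetric.1 isSelfAdjoint_mulSq) S S

/-- **Energy identity for weak eigenfunctions** (Parseval): if
`Λ_{m,k} ⟪e_k, S⟫ - ν² ⟪e_k, x² S⟫ = λ ⟪e_k, S⟫` for all `k`, then
`∑_k Λ_{m,k} |⟪e_k, S⟫|² = λ ‖S‖² + ν² Re ⟪S, x² S⟫` (so `S` lies in the form domain).
[cite: DafermosRodnianskiShlapentokhrothman2014, §5.2.1 (32)] -/
theorem hasSum_level_mul_norm_sq {m : ℕ} {ν : ℝ} {S : Lp ℂ 2 legendreMeasure} {lam : ℝ}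
    (heq : ∀ k : ℕ, (assocLegLevel m k : ℂ) * ⟪assocLegBasis m k, S⟫_ℂ -
      ((ν ^ 2 : ℝ) : ℂ) * ⟪assocLegBasis m k, mulSq S⟫_ℂ = (lam : ℂ) * ⟪assocLegBasis m k, S⟫_ℂ) :
    HasSum (fun k ↦ assocLegLevel m k * ‖⟪assocLegBasis m k, S⟫_ℂ‖ ^ 2)
      (lam * ‖S‖ ^ 2 + ν ^ 2 * (⟪S, mulSq S⟫_ℂ).re) := by
  set R : Lp ℂ 2 legendreMeasure := (lam : ℂ) • S + ((ν ^ 2 : ℝ) : ℂ) • mulSq S with hR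
  have hk : ∀ k, (assocLegLevel m k : ℂ) * ⟪assocLegBasis m k, S⟫_ℂ =
      ⟪assocLegBasis m k, R⟫_ℂ := fun k ↦ by
    rw [hR, inner_add_right, inner_smul_right, inner_smul_right]
    linear_combination heq k
  have hP := (assocLegBasis m).hasSum_inner_mul_inner S R
  have hfun : (fun k ↦ ⟪S, assocLegBasis m k⟫_ℂ * ⟪assocLegBasis m k, R⟫_ℂ) =
      fun k ↦ ((assocLegLevel m k * ‖⟪assocLegBasis m k, S⟫_ℂ‖ ^ 2 : ℝ) : ℂ) := by
    funext k
    rw [← hk k, ← inner_conj_symm S, mul_left_comm, Complex.conj_mul']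
    push_cast
    ring
  have hval : ⟪S, R⟫_ℂ = ((lam * ‖S‖ ^ 2 + ν ^ 2 * (⟪S, mulSq S⟫_ℂ).re : ℝ) : ℂ) := by
    have hre := inner_mulSq_self_eq_re S
    have hSS : ⟪S, S⟫_ℂ = ((‖S‖ ^ 2 : ℝ) : ℂ) := by
      rw [inner_self_eq_norm_sq_to_K]
      norm_cast
    rw [hR, inner_add_right, inner_smul_right, inner_smul_right, hSS]
    conv_lhs => rw [hre]
    push_cast
    ring
  rw [hfun, hval] at hP
  exact (RCLike.hasSum_ofReal (𝕜 := ℂ)).1 (by exact_mod_cast hP)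

/-- **DRSR (34): `λ + ν² ≥ 2 m |ν|` for every nonzero weak eigenfunction of the order-`m` oblate
spheroidal operator.** [cite: DafermosRodnianskiShlapentokhrothman2014, §5.2.1 (34)] -/
theorem lowerBound_of_weak {m : ℕ} {ν : ℝ} {S : Lp ℂ 2 legendreMeasure} {lam : ℝ} (hS : S ≠ 0)
    (heq : ∀ k : ℕ, (assocLegLevel m k : ℂ) * ⟪assocLegBasis m k, S⟫_ℂ -
      ((ν ^ 2 : ℝ) : ℂ) * ⟪assocLegBasis m k, mulSq S⟫_ℂ = (lam : ℂ) * ⟪assocLegBasis m k, S⟫_ℂ) :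
    2 * m * |ν| - ν ^ 2 ≤ lam := by
  have hE := hasSum_level_mul_norm_sq heq
  have hT := tendsto_truncation m S
  -- the three limits
  have hlim1 : Tendsto (fun N ↦ ∑ k ∈ range N, assocLegLevel m k * ‖⟪assocLegBasis m k, S⟫_ℂ‖ ^ 2)
      atTop (𝓝 (lam * ‖S‖ ^ 2 + ν ^ 2 * (⟪S, mulSq S⟫_ℂ).re)) := hE.tendsto_sum_nat
  have hlim2 : Tendsto (fun N ↦ (⟪truncation m S N, mulSq (truncation m S N)⟫_ℂ).re) atTop
      (𝓝 ((⟪S, mulSq S⟫_ℂ).re)) :=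
    (Complex.continuous_re.tendsto _).comp (hT.inner ((mulSq.continuous.tendsto S).comp hT))
  have hlim3 : Tendsto (fun N ↦ ‖truncation m S N‖ ^ 2) atTop (𝓝 (‖S‖ ^ 2)) :=
    (hT.norm).pow 2
  have hle : (2 * m * |ν| - ν ^ 2) * ‖S‖ ^ 2 ≤
      lam * ‖S‖ ^ 2 + ν ^ 2 * (⟪S, mulSq S⟫_ℂ).re - ν ^ 2 * (⟪S, mulSq S⟫_ℂ).re :=
    le_of_tendsto_of_tendsto' (hlim3.const_mul _) (hlim1.sub (hlim2.const_mul _))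
      fun N ↦ truncation_ineq m S N ν
  have hpos : 0 < ‖S‖ ^ 2 := by positivity
  nlinarith

/-- **DRSR (34) for the eigenbasis of `exists_hilbertBasis_oblateSpheroidal`**: every Hilbert
basis of weak eigenfunctions as produced there has `2 m |ν| - ν² ≤ λ_j` for all `j`.
[cite: DafermosRodnianskiShlapentokhrothman2014, §5.2.1 (34)] -/
theorem lowerBound_of_hilbertBasis {m : ℕ} {ν : ℝ} {s : Set (Lp ℂ 2 legendreMeasure)}
    (S : HilbertBasis s ℂ (Lp ℂ 2 legendreMeasure)) (lam : s → ℝ)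
    (heq : ∀ j (k : ℕ), (assocLegLevel m k : ℂ) * ⟪assocLegBasis m k, S j⟫_ℂ -
      ((ν ^ 2 : ℝ) : ℂ) * ⟪assocLegBasis m k, mulSq (S j)⟫_ℂ =
        (lam j : ℂ) * ⟪assocLegBasis m k, S j⟫_ℂ) (j : s) :
    2 * m * |ν| - ν ^ 2 ≤ lam j :=
  lowerBound_of_weak (S.orthonormal.ne_zero j) (heq j)

/-- **Both printed bounds together** for the basis of `exists_hilbertBasis_oblateSpheroidal`:
there is a Hilbert basis of weak eigenfunctions with `λ_j → ∞`,
`λ_j + ν² ≥ m(m+1)` ((33)) and `λ_j + ν² ≥ 2m|ν|` ((34)).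
[cite: DafermosRodnianskiShlapentokhrothman2014, §5.2.1 (33)–(34)] -/
theorem exists_hilbertBasis_oblateSpheroidal_bounds (m : ℕ) (ν : ℝ) :
    ∃ (s : Set (Lp ℂ 2 legendreMeasure)) (S : HilbertBasis s ℂ (Lp ℂ 2 legendreMeasure))
      (lam : s → ℝ), ⇑S = ((↑) : s → Lp ℂ 2 legendreMeasure) ∧ Tendsto lam cofinite atTop ∧
      (∀ j, (m : ℝ) * (m + 1) - ν ^ 2 ≤ lam j) ∧ (∀ j, 2 * m * |ν| - ν ^ 2 ≤ lam j) ∧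
      ∀ j (k : ℕ), (assocLegLevel m k : ℂ) * ⟪assocLegBasis m k, S j⟫_ℂ -
        ((ν ^ 2 : ℝ) : ℂ) * ⟪assocLegBasis m k, mulSq (S j)⟫_ℂ =
          (lam j : ℂ) * ⟪assocLegBasis m k, S j⟫_ℂ := by
  obtain ⟨s, S, lam, hcoe, htend, hb1, heq⟩ := exists_hilbertBasis_oblateSpheroidal m ν
  exact ⟨s, S, lam, hcoe, htend, hb1, lowerBound_of_hilbertBasis S lam heq, heq⟩

end Literature.Analysis.SpecialFunctions
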